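import Literature.Probability.Percolation.CLE6Proofs
import Literature.Probability.Percolation.CLE6Rerooting
import Mathlib.MeasureTheory.Measure.HasOuterApproxClosed
import Mathlib.MeasureTheory.Integral.BoundedContinuousFunction
import Mathlib.Topology.MetricSpace.Closeds
import Mathlib.Topology.MetricSpace.Thickening
import HarnessLib

/-!
# Scaling limits of the percolation loop collections are carried by loops in the closed domain

Topic `Literature/Probability/Percolation`, companion to `CLE6.lean` (proofs only, no new
definitions, no new named facts). `CLE6.lean` states the Camia–Newman full scaling limit in the
unrooted form printed in the sources, `exists_isCNLFamily_tendsto`: there is a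
Continuum-Nonsimple-Loop family `ν` (`IsCNLFamily ν`) such that, for every Jordan domain `D`, the
loop collections `triLoopCollection D δ` of critical site percolation converge in law
(`TendstoLaw`, limit variable `id`) to `ν D` (F. Camia, C. M. Newman, MSRI Publ. 55 (2008),
Thms 2–3; Comm. Math. Phys. 268 (2006), Thms 1, 2, 5, 7). Its proof (MSRI 55, §5) starts from
Aizenman–Burchard tightness, so that `ν D` arises as a (subsequential) limit in law, and must then
establish the fields of `IsCNLFamily` for the limit. This file proves, once and for all, the part
of that verification which is "soft", i.e. which holds for **every** probability law `P'` that is a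
limit in law of the loop collections in `D`:

* `TendstoLaw.integral_eq_one_of_eventually`, `TendstoLaw.measure_eq_one_of_isClosed`,
  `TendstoLaw.ae_mem_of_isClosed` — the closed-set half of the portmanteau theorem for the
  combinator `TendstoLaw … id P'` (Billingsley, *Convergence of probability measures*, 2nd ed.,
  Thm 2.1 (iii)) in the only case needed here: a closed set `F` that carries the approximating
  random variables almost surely for all small `δ > 0` has full `P'`-measure. Proof from Mathlib's
  `HasOuterApproxClosed` API (`IsClosed.apprSeq`, `tendsto_lintegral_apprSeq`): the integral of
  each approximating test function is eventually `1`, hence `1` in the limit. No measurability of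
  the approximating variables is needed.
* `isClosed_setOf_forall_range_subset` — "every member has its trace in the closed set `S`" is a
  closed condition on the Aizenman–Burchard space `LoopSpace ℂ`
  (`Closeds.isClosed_subsets_of_isClosed`, `CurveClass.isClosed_rangeSubset`).
* `ae_forall_isLoop_of_tendstoLaw` — every limit law of `triLoopCollection D δ` is carried by
  collections of loops (the field `IsCNLFamily.ae_isLoop`): the collections at mesh `δ` consist of
  loops (`isLoop_of_mem_triLoopCollection`) and loop collections form a closed set
  (`isClosed_setOf_forall_isLoop`).
* `ae_forall_range_subset_cthickening_of_tendstoLaw`, `ae_inDomain_of_tendstoLaw` — every limit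
  law is carried by collections of curves in `D̄` (the field `IsCNLFamily.ae_inDomain`): at mesh
  `δ ≤ η` all traces lie in the closed `η`-thickening of `D`
  (`range_subset_cthickening_of_mem_triLoopCollection_holds`), a closed condition, and
  `⋂_η cthickening η D = closure D` (`Metric.closure_eq_iInter_cthickening`).
* `IsCNLFamily.of_tendstoLaw`, `exists_isCNLFamily_tendsto_of_tendstoLaw` — the resulting
  reduction of `exists_isCNLFamily_tendsto`: a family of probability laws `ν D` that are limits in
  law of the loop collections is a CNL family as soon as the four remaining ("hard") properties
  hold — reroot-saturation, finiteness of the number of traces of diameter `> ε`, infinitely many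
  non-trivial traces, conformal invariance (Camia–Newman, CMP 268 (2006), Thm 2 and §§5–6;
  MSRI 55 (2008), Thm 3). These remain hypotheses here; they are the content of the
  Camia–Newman theorem proper (exploration paths → `SLE₆`, the coupled lattice/continuum
  constructions, RSW bounds), not consequences of soft arguments.

## References

* F. Camia, C. M. Newman, *SLE₆ and CLE₆ from critical percolation*, MSRI Publ. 55 (2008),
  Thms 2–3 and §5 [CamiaNewman2008].
* F. Camia, C. M. Newman, *Two-dimensional critical percolation: the full scaling limit*,
  Comm. Math. Phys. 268 (2006), 1–38, Thms 1–2, §2.2 [CamiaNewman2006].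
* P. Billingsley, *Convergence of probability measures*, 2nd ed. (1999), Thm 2.1 [Billingsley1999].
-/

noncomputable section

open Set Filter Metric MeasureTheory
open scoped ENNReal NNReal Topology BoundedContinuousFunction

namespace Literature.Probability.Percolation

open RandomPlanarGeometry

/-! ### Portmanteau (closed-set half) for `TendstoLaw` with the identity limit variable -/

section Portmanteau

variable {Ωδ : ℝ → Type*} [∀ δ, MeasurableSpace (Ωδ δ)] {X : Type*} [TopologicalSpace X]
  [MeasurableSpace X] {Y : ∀ δ, Ωδ δ → X} {P : ∀ δ, Measure (Ωδ δ)}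
  [∀ δ, IsProbabilityMeasure (P δ)] {P' : Measure X}

/-- If `Y δ → P'` in law (`TendstoLaw`, limit variable `id`, probability measures) and a bounded
continuous test function `f` equals `1` almost surely on the sample `Y δ` for all small `δ > 0`,
then `∫ f dP' = 1`: the approximating integrals are eventually equal to `1`
(Billingsley 1999, §2, definition of weak convergence). [folklore] -/
theorem _root_.Literature.Probability.RandomPlanarGeometry.TendstoLaw.integral_eq_one_of_eventually
    (h : TendstoLaw Y P id P') (f : X →ᵇ ℝ)
    (hf : ∀ᶠ δ in 𝓝[>] (0 : ℝ), ∀ᵐ ω ∂P δ, f (Y δ ω) = 1) : ∫ x, f x ∂P' = 1 := by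
  have h1 : Tendsto (fun δ ↦ ∫ ω, f (Y δ ω) ∂P δ) (𝓝[>] (0 : ℝ)) (𝓝 1) := by
    refine tendsto_const_nhds.congr' ?_
    filter_upwards [hf] with δ hδ
    rw [integral_congr_ae hδ]
    simp
  have h2 := tendsto_nhds_unique (h f) h1
  simpa using h2

variable [OpensMeasurableSpace X] [HasOuterApproxClosed X] [IsProbabilityMeasure P']

/-- **Portmanteau, closed-set half, for `TendstoLaw`** (Billingsley 1999, Thm 2.1 (iii):
`limsup P_δ(F) ≤ P'(F)` for closed `F`; here in the extreme case `P_δ(Y δ ∈ F) = 1`). If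
`Y δ → P'` in law with limit variable `id` (probability measures, `X` with outer approximation
of closed sets, e.g. any pseudo-emetric space) and the closed set `F` carries `Y δ` almost surely
for all small `δ > 0`, then `P' F = 1`. Proof: for the approximating sequence `fₙ ↓ 𝟙_F` of
bounded continuous functions (`IsClosed.apprSeq`: `fₙ = 1` on `F`, `fₙ ≤ 1`) each `∫ fₙ dP'`
equals `1` by `TendstoLaw.integral_eq_one_of_eventually`, and `∫ fₙ dP' → P' F`
(`HasOuterApproxClosed.tendsto_lintegral_apprSeq`). No measurability of `Y δ` is needed.
[cite: Billingsley1999, Thm 2.1] -/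
theorem _root_.Literature.Probability.RandomPlanarGeometry.TendstoLaw.measure_eq_one_of_isClosed
    (h : TendstoLaw Y P id P') {F : Set X} (hF : IsClosed F)
    (hYF : ∀ᶠ δ in 𝓝[>] (0 : ℝ), ∀ᵐ ω ∂P δ, Y δ ω ∈ F) : P' F = 1 := by
  have hlim := HasOuterApproxClosed.tendsto_lintegral_apprSeq hF P'
  have hconst : ∀ n, ∫⁻ x, (hF.apprSeq n x : ℝ≥0∞) ∂P' = 1 := by
    intro n
    set g : X →ᵇ ℝ :=
      BoundedContinuousFunction.comp _ NNReal.isometry_coe.lipschitz (hF.apprSeq n) with hg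
    have hg1 : ∫ x, g x ∂P' = 1 := by
      refine h.integral_eq_one_of_eventually g ?_
      filter_upwards [hYF] with δ hδ
      filter_upwards [hδ] with ω hω
      simp [hg, HasOuterApproxClosed.apprSeq_apply_eq_one hF n hω]
    have hfin : ∫⁻ x, (hF.apprSeq n x : ℝ≥0∞) ∂P' ≠ ∞ :=
      ((hF.apprSeq n).lintegral_lt_top_of_nnreal P').ne
    have htoReal : (∫⁻ x, (hF.apprSeq n x : ℝ≥0∞) ∂P').toReal = 1 := by
      rw [BoundedContinuousFunction.toReal_lintegral_coe_eq_integral]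
      simpa [hg] using hg1
    rw [← ENNReal.ofReal_toReal hfin, htoReal, ENNReal.ofReal_one]
  simp_rw [hconst] at hlim
  exact (tendsto_const_nhds_iff.1 hlim).symm

/-- Almost-sure form of `TendstoLaw.measure_eq_one_of_isClosed`: a closed set carrying the
approximating random variables almost surely for all small `δ > 0` carries the limit law
(Billingsley 1999, Thm 2.1 (iii)). [cite: Billingsley1999, Thm 2.1] -/
theorem _root_.Literature.Probability.RandomPlanarGeometry.TendstoLaw.ae_mem_of_isClosed
    (h : TendstoLaw Y P id P') {F : Set X} (hF : IsClosed F)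
    (hYF : ∀ᶠ δ in 𝓝[>] (0 : ℝ), ∀ᵐ ω ∂P δ, Y δ ω ∈ F) : ∀ᵐ x ∂P', x ∈ F := by
  rw [ae_iff]
  change P' Fᶜ = 0
  rw [prob_compl_eq_zero_iff hF.measurableSet]
  exact h.measure_eq_one_of_isClosed hF hYF

end Portmanteau

/-! ### Every scaling limit of the loop collections is carried by loops in `D̄` -/

section CritPerc

open LatticeModels

/-- "Every member of the collection has its trace in `S`" is a closed condition on the
Aizenman–Burchard space for a closed `S ⊆ ℂ`: curves with trace in `S` form a closed set of
curve space (`CurveClass.isClosed_rangeSubset`) and closed sub-collections of a closed set form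
a closed set for the Hausdorff topology (`Closeds.isClosed_subsets_of_isClosed`)
(Aizenman–Burchard, Duke Math. J. 99 (1999), §2.1). [folklore] -/
theorem isClosed_setOf_forall_range_subset {S : Set ℂ} (hS : IsClosed S) :
    IsClosed {L : LoopSpace ℂ | ∀ c ∈ L, CurveClass.range c ⊆ S} :=
  TopologicalSpace.Closeds.isClosed_subsets_of_isClosed (CurveClass.isClosed_rangeSubset hS)

variable (D : JordanDomain) {P' : Measure (LoopSpace ℂ)} [IsProbabilityMeasure P']

/-- **Scaling limits of the loop collections are carried by loops** (the field
`IsCNLFamily.ae_isLoop` for any limit law; Camia–Newman, CMP 268 (2006), Thm 1 and §2.2). If the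
percolation loop collections `triLoopCollection D δ` converge in law (limit variable `id`) to a
probability law `P'` on `LoopSpace ℂ`, then `P'`-almost every collection consists of loops: at
each mesh the collection consists of loops (`isLoop_of_mem_triLoopCollection`), a closed
condition (`isClosed_setOf_forall_isLoop`), so the portmanteau theorem applies
(`TendstoLaw.ae_mem_of_isClosed`). [cite: CamiaNewman2006, Thm 1] -/
theorem ae_forall_isLoop_of_tendstoLaw
    (h : TendstoLaw (Ωδ := fun _ ↦ SiteConfig (Site 2)) (fun δ ↦ triLoopCollection D δ)
      (fun _ ↦ triSitePercolation half) id P') :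
    ∀ᵐ L ∂P', ∀ c ∈ (L : LoopSpace ℂ), CurveClass.IsLoop c :=
  h.ae_mem_of_isClosed (F := {L : LoopSpace ℂ | ∀ c ∈ L, CurveClass.IsLoop c})
    isClosed_setOf_forall_isLoop
    (Eventually.of_forall fun _ ↦ ae_of_all _ fun _ _ hc ↦ isLoop_of_mem_triLoopCollection hc)

/-- At every fixed scale `η > 0`, a limit law of the loop collections in `D` is carried by
collections of curves with trace in the closed `η`-thickening of `D`: for `0 < δ ≤ η` every
member of `triLoopCollection D δ ω` has trace in `cthickening δ D ⊆ cthickening η D`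
(`range_subset_cthickening_of_mem_triLoopCollection_holds`), a closed condition
(`isClosed_setOf_forall_range_subset`), and `(0, η] ∈ 𝓝[>] 0` (Camia–Newman, MSRI 55 (2008),
Thm 2: loops of percolation *in `D`*). [cite: CamiaNewman2008, Thm 2] -/
theorem ae_forall_range_subset_cthickening_of_tendstoLaw
    (h : TendstoLaw (Ωδ := fun _ ↦ SiteConfig (Site 2)) (fun δ ↦ triLoopCollection D δ)
      (fun _ ↦ triSitePercolation half) id P') {η : ℝ} (hη : 0 < η) :
    ∀ᵐ L ∂P', ∀ c ∈ (L : LoopSpace ℂ), CurveClass.range c ⊆ cthickening η D.carrier := by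
  refine h.ae_mem_of_isClosed
    (F := {L : LoopSpace ℂ | ∀ c ∈ L, CurveClass.range c ⊆ cthickening η D.carrier})
    (isClosed_setOf_forall_range_subset isClosed_cthickening) ?_
  filter_upwards [Ioc_mem_nhdsGT hη] with δ hδ
  exact ae_of_all _ fun ω c hc ↦
    (range_subset_cthickening_of_mem_triLoopCollection_holds hδ.1 hc).trans
      (cthickening_mono hδ.2 _)

/-- **Scaling limits of the loop collections live in the closed domain** (the field
`IsCNLFamily.ae_inDomain` for any limit law; Camia–Newman, MSRI 55 (2008), Thm 2). If the
percolation loop collections in `D` converge in law (limit variable `id`) to a probability law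
`P'`, then `P'`-almost every collection has all its traces in `closure D`: combine
`ae_forall_range_subset_cthickening_of_tendstoLaw` over `η = 1/(n+1)` (`ae_all_iff`) with
`closure D = ⋂_{η>0} cthickening η D` (`Metric.closure_eq_iInter_cthickening`).
[cite: CamiaNewman2008, Thm 2] -/
theorem ae_inDomain_of_tendstoLaw
    (h : TendstoLaw (Ωδ := fun _ ↦ SiteConfig (Site 2)) (fun δ ↦ triLoopCollection D δ)
      (fun _ ↦ triSitePercolation half) id P') :
    ∀ᵐ L ∂P', LoopSpace.InDomain D L := by
  have hall : ∀ᵐ L ∂P', ∀ n : ℕ, ∀ c ∈ (L : LoopSpace ℂ),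
      CurveClass.range c ⊆ cthickening (1 / ((n : ℝ) + 1)) D.carrier :=
    ae_all_iff.2 fun n ↦
      ae_forall_range_subset_cthickening_of_tendstoLaw D h Nat.one_div_pos_of_nat
  filter_upwards [hall] with L hL c hc x hx
  rw [closure_eq_iInter_cthickening]
  simp only [mem_iInter]
  intro ε hε
  obtain ⟨n, hn⟩ := exists_nat_one_div_lt hε
  exact cthickening_mono hn.le _ (hL n c hc hx)

/-- **Constructor of CNL families from scaling limits.** A family `ν` of probability laws on
`LoopSpace ℂ` such that every `ν D` is a limit in law of the percolation loop collections
`triLoopCollection D δ` is a Continuum-Nonsimple-Loop family (`IsCNLFamily`) provided the four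
"hard" Camia–Newman properties hold — almost sure reroot-saturation (CMP 268 (2006), §2.2,
§3.2), finitely many traces of diameter `> ε` (Thm 2 (ii), Thm 5), infinitely many non-trivial
traces (Thm 2 (ii)) and conformal invariance (MSRI 55 (2008), Thm 3; CMP 268, Thm 7); the two
"soft" fields `ae_isLoop`, `ae_inDomain` are automatic (`ae_forall_isLoop_of_tendstoLaw`,
`ae_inDomain_of_tendstoLaw`). [cite: CamiaNewman2008, Theorems 2–3] -/
theorem IsCNLFamily.of_tendstoLaw {ν : JordanDomain → Measure (LoopSpace ℂ)}
    (hP : ∀ D, IsProbabilityMeasure (ν D))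
    (hlim : ∀ D : JordanDomain, TendstoLaw (Ωδ := fun _ ↦ SiteConfig (Site 2))
      (fun δ ↦ triLoopCollection D δ) (fun _ ↦ triSitePercolation half) id (ν D))
    (hsat : ∀ D, ∀ᵐ L ∂(ν D), LoopSpace.rerootSaturation L = L)
    (hfin : ∀ D, ∀ᵐ L ∂(ν D), ∀ ε : ℝ, 0 < ε →
      {s : Set ℂ | ∃ c ∈ L, CurveClass.range c = s ∧ ε < Metric.diam s}.Finite)
    (hinf : ∀ D, ∀ᵐ L ∂(ν D),
      {s : Set ℂ | ∃ c ∈ L, ¬ CurveClass.IsTrivial c ∧ CurveClass.range c = s}.Infinite)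
    (hconf : ∀ (D D' : JordanDomain) (φ : ConformalEquiv D.carrier D'.carrier) (Φ : C(ℂ, ℂ)),
      EqOn Φ φ D.carrier → MapsTo Φ (closure D.carrier) (closure D'.carrier) →
        ν D' = (ν D).map (LoopSpace.map Φ)) :
    IsCNLFamily ν where
  isProbabilityMeasure := hP
  ae_inDomain D := by
    haveI := hP D
    exact ae_inDomain_of_tendstoLaw D (hlim D)
  ae_isLoop D := by
    haveI := hP D
    exact ae_forall_isLoop_of_tendstoLaw D (hlim D)
  ae_rerootSaturation_eq := hsat
  ae_finite_traces := hfin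
  ae_infinite_traces := hinf
  conformal_invariance := hconf

/-- **Reduction of `exists_isCNLFamily_tendsto` to the hard Camia–Newman inputs.** To prove the
unrooted full-scaling-limit statement it suffices to exhibit probability laws `ν D` that are
limits in law of the loop collections in every Jordan domain `D` (existence and uniqueness of
the limit: Aizenman–Burchard tightness plus the Camia–Newman identification, MSRI 55 (2008), §5)
and to verify reroot-saturation, local finiteness of traces, infinitude of non-trivial traces
and conformal invariance for them; membership of the traces in `D̄` and the loop property come
for free (`IsCNLFamily.of_tendstoLaw`). [cite: CamiaNewman2008, Theorems 2–3] -/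
theorem exists_isCNLFamily_tendsto_of_tendstoLaw (ν : JordanDomain → Measure (LoopSpace ℂ))
    (hP : ∀ D, IsProbabilityMeasure (ν D))
    (hlim : ∀ D : JordanDomain, TendstoLaw (Ωδ := fun _ ↦ SiteConfig (Site 2))
      (fun δ ↦ triLoopCollection D δ) (fun _ ↦ triSitePercolation half) id (ν D))
    (hsat : ∀ D, ∀ᵐ L ∂(ν D), LoopSpace.rerootSaturation L = L)
    (hfin : ∀ D, ∀ᵐ L ∂(ν D), ∀ ε : ℝ, 0 < ε →
      {s : Set ℂ | ∃ c ∈ L, CurveClass.range c = s ∧ ε < Metric.diam s}.Finite)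
    (hinf : ∀ D, ∀ᵐ L ∂(ν D),
      {s : Set ℂ | ∃ c ∈ L, ¬ CurveClass.IsTrivial c ∧ CurveClass.range c = s}.Infinite)
    (hconf : ∀ (D D' : JordanDomain) (φ : ConformalEquiv D.carrier D'.carrier) (Φ : C(ℂ, ℂ)),
      EqOn Φ φ D.carrier → MapsTo Φ (closure D.carrier) (closure D'.carrier) →
        ν D' = (ν D).map (LoopSpace.map Φ)) :
    exists_isCNLFamily_tendsto :=
  ⟨ν, IsCNLFamily.of_tendstoLaw hP hlim hsat hfin hinf hconf, hlim⟩

end CritPerc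

end Literature.Probability.Percolation
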